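/-
Copyright (c) 2026 the pub-hodgecm-mathlib formalisation cell (harness21).  Prover seat hodgecm-mathlib-LH7-p04 (g13), 2026-09-03.  Line LH4 ∕ L2-3 «CM glue» of the dyadic
(D-UNR) road (census `CENSUS-L23-CM.v1.LH10p01g12.md` ROW 2, fence `φ_θ` everywhere, LEAD T15-55): the 2-FREE twin «BINDERS-θ TYPE (1)» of ★ `TypeOneCayleyShiftBindersCM`, FILE A of two
(§§1–2: scalars and the TYPE-FREE unit denominators; file B `TypeOneHermitianShiftBindersCM` = §§3–4) — the σ-fixed pair `(c+1, c−1 ∣ c−1, c+1)` (which needs `|2|_w = 1`) is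
replaced by the HERMITIAN pair `(θ, c−θ ∣ c−σθ, σθ)`, `θ + σθ = 1`, `|θ|_w ≤ 1` (any residue characteristic).
-/
import Literature.NumberTheory.Rogawski1990.TypeTwoCayleyShiftBindersCM        -- ★ γ₃ (pattern; §1 `map_smul_add_smul_one`, `smul_reindex_add_smul_one`, `smul_fromBlocks_add_smul_one`); brings ★ γ₂ γ₁ α β, ★ `trace_sq_sub_four_det_one_add_smul`
import Literature.NumberTheory.Automorphic.TypeTwoHermitianMoebiusShiftFrame   -- ★ P3 (LH10-p01 (g12)): `valued_hermitianShift_denominators_of_unitary_of_exp`; brings ★ P2 `hermitianPair_key_scalar`, `eval_charpoly_genMoebius_fin_two`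
import HarnessLib

/-!
# The hermitian Cayley shift at a CM place, type-free — no `|2| = 1` (file A): the scalar shift on `2`-deep points, and unit denominators under `|disc χ_{g_w}|_w < exp(−2)`

Topic `NumberTheory/Rogawski1990`; namespaces `Literature.NumberTheory.Automorphic.MoebiusShift` (§1, scalars) and `Literature.NumberTheory.Rogawski1990` (§2).  THEOREMS ONLY
(no definition, no instance, no notation, no named fact, no `sorry`); kernel lane `--supports stmt-HodgeConjecture-24833`.  Cell `pub/hodgecm-mathlib`, crux H413; line LH4, organ
`stub_DyUnramCore` ∕ L2-3, CM-glue road (carriers ★ `TypeTwoHermitianShiftCM`, (A3)-θ ★ `FinExplicitTransferFactorHermitianShiftSum`, LH4-p01 (g12); type (2) binders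
`TypeTwoHermitianShiftBindersCM`, this seat).  Files A+B are the θ-twin of ★ `TypeOneCayleyShiftBindersCM` (F0P2-p02 (g11)) token for token, with `h2 : |2|_w = 1` REPLACED by the
road's hermitian binders `(θ : LocalRing L v) (hθ : θ + conjLocal θ = 1) (hθv : |θ_w| ≤ 1)`, `h4c : IsUnit ((c+1)² − (c−1)²)` by `hΔ : IsUnit (θσθ − (c−θ)(c−σθ))`, and the pair
`(c+1, c−1 ∣ c−1, c+1) ↦ (θ, c−θ ∣ c−σθ, σθ)`.  HONEST LABEL: HC_CM is proved only modulo the cell's 2 remaining named inputs (hLiu418, h413) until rung 0 closes; this file is an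
ASSEMBLY over ★ material and asserts nothing printed.

THE MATHEMATICS.  `w ∣ v` non-split, `c ∈ E_v` with `σ(c) = c`, `|c_w| = exp(−1)`; `θ ∈ E_v`, `θ + σθ = 1`, `|θ_w| ≤ 1`; `φ_θ(M) = (θM + (c−θ))((c−σθ)M + σθ)⁻¹`, on scalars
`φ_θ(x) = (θx + (c−θ)) ∕ ((c−σθ)x + σθ)`.  §1 (scalars, any valued field): `φ(x) − φ(y) = (aa′ − bb′)(x − y) ∕ (D_x D_y)` for four scalars; for the hermitian pair `aa′ − bb′ =
θσθ − (c−θ)(c−σθ) = c(1−c)` (★ P2 `hermitianPair_key_scalar`) and `D_x = (c−σθ)x + σθ = c + (c−σθ)(x−1)`, so for `|x − 1| ≤ exp(−2)`: `|D_x| = exp(−1)`, `|φ_θ x − φ_θ y| =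
q·|x − y|`; and `|φ_θ x − 1| ≤ exp(−1)` (★ P1 `valued_hermitianMoebius_scalar_sub_one_le_of_level`).  §2 (type-free twin of `isUnit_hermitianShift_denominators_of_typeTwo`): for
`γ_H = (g, u)` DEEP with `|disc χ_{g_w}|_w < exp(−2)` (type (2): `exp(−(2N+1))`, `N ≥ 1`; type (1): `exp(−2N)`, `N ≥ 2`) the eleven hermitian denominator facts hold (★ P3
`valued_hermitianShift_denominators_of_unitary_of_exp` from unitarity of `g_w = 1 + c_w X` for `J = antidiag(1,1)`).  File B: §3 the type-(1) shifted roots, §4 «non-Levi is preserved».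

## References
* [Rogawski1990] J. D. Rogawski, *Automorphic Representations of Unitary Groups in Three Variables*, Ann. of Math. Stud. 123 (1990), §4.9 Prop. 4.9.1 (a)(b) p. 55; §4.3 p. 42.
* [Kottwitz1986BaseChangeUnits] R. E. Kottwitz, *Base change for unit elements of Hecke algebras*, Compositio Math. 60 (1986), §2 pp. 244–247.
* [Flicker1998UnitaryFL] Y. Z. Flicker, *Elementary proof of the fundamental lemma for a unitary group*, Canad. J. Math. 50 (1998), §6.
* [SerreLocalFields1979] J.-P. Serre, *Local Fields*, GTM 67 (1979), Ch. I §§1–2 (discrete valuations).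
-/

set_option autoImplicit false

noncomputable section

open NumberField IsDedekindDomain Matrix Polynomial
open scoped MatrixGroups WithZero

/-! ## §1 Scalars: the hermitian Möbius shift on roots, in a valued field -/

namespace Literature.NumberTheory.Automorphic.MoebiusShift

section Scalar

variable {K : Type*} [Field K] [Valued K ℤᵐ⁰]

omit [Valued K ℤᵐ⁰] in
/-- `φ(x) − φ(y) = (aa′ − bb′)(x − y) ∕ ((b′x + a′)(b′y + a′))` for the four-scalar Möbius map `φ(x) = (ax + b)∕(b′x + a′)`. [cite: Kottwitz1986BaseChangeUnits, §2 pp. 244–247] -/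
theorem genMoebius_scalar_sub_genMoebius_scalar (a b a' b' x y : K) (hx : b' * x + a' ≠ 0) (hy : b' * y + a' ≠ 0) :
    (a * x + b) / (b' * x + a') - (a * y + b) / (b' * y + a') = (a * a' - b * b') * (x - y) / ((b' * x + a') * (b' * y + a')) := by
  rw [div_sub_div _ _ hx hy]
  congr 1
  ring

/-- **The hermitian scalar denominators at a `2`-deep point**: `|x − 1| ≤ exp(−2)`, `|c| = exp(−1)`, `θ + σθ = 1`, `|θ| ≤ 1` ⇒ `|(c−σθ)x + σθ| = exp(−1) = |θx + (c−θ)|`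
(`(c−σθ)x + σθ = c + (c−σθ)(x − 1)`, `θx + (c−θ) = c + θ(x − 1)`; NO `|2| = 1`). [cite: Kottwitz1986BaseChangeUnits, §2 pp. 244–247] [cite: SerreLocalFields1979, Ch. I §§1–2] -/
theorem valued_hermitianShift_scalar_denominators_of_deep (σ : K →+* K) {θ : K} (hθ : θ + σ θ = 1) (hθv : Valued.v θ ≤ 1) {c : K}
    (hc : Valued.v c = WithZero.exp (-1 : ℤ)) {x : K} (hx : Valued.v (x - 1) ≤ WithZero.exp (-2 : ℤ)) :
    Valued.v ((c - σ θ) * x + σ θ) = WithZero.exp (-1 : ℤ) ∧ Valued.v (θ * x + (c - θ)) = WithZero.exp (-1 : ℤ) := by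
  obtain ⟨-, hc1, -, -, -, -⟩ := shift_parameter_facts hc
  have hσθ : σ θ = 1 - θ := by linear_combination hθ
  have hσθv : Valued.v (σ θ) ≤ 1 := by rw [hσθ]; exact (Valuation.map_sub _ _ _).trans (max_le (by rw [map_one]) hθv)
  have htD : Valued.v (c - σ θ) ≤ 1 := (Valuation.map_sub _ _ _).trans (max_le hc1.le hσθv)
  have hlt : WithZero.exp (-2 : ℤ) < WithZero.exp (-1 : ℤ) := by rw [WithZero.exp_lt_exp]; norm_num
  have hsmall : ∀ {t : K}, Valued.v t ≤ 1 → Valued.v (t * (x - 1)) < Valued.v c := fun {t} ht => by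
    rw [map_mul, hc]; exact lt_of_le_of_lt (mul_le_of_le_one_left' ht) (lt_of_le_of_lt hx hlt)
  have eD : (c - σ θ) * x + σ θ = c + (c - σ θ) * (x - 1) := by ring
  have eN : θ * x + (c - θ) = c + θ * (x - 1) := by ring
  exact ⟨by rw [eD, Valuation.map_add_eq_of_lt_left _ (hsmall htD), hc], by rw [eN, Valuation.map_add_eq_of_lt_left _ (hsmall hθv), hc]⟩

/-- **`|φ_θ x − φ_θ y| = q·|x − y|`** for `2`-deep `x, y` (`φ_θ x − φ_θ y = c(1−c)(x−y)∕(D_x D_y)`, `|c(1−c)| = exp(−1)`, `|D_x| = |D_y| = exp(−1)`; NO `|2| = 1`).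
[cite: Kottwitz1986BaseChangeUnits, §2 pp. 244–247] [cite: Rogawski1990, §4.9 Prop. 4.9.1 (b) p. 55] -/
theorem valued_hermitianMoebius_scalar_sub (σ : K →+* K) {θ : K} (hθ : θ + σ θ = 1) (hθv : Valued.v θ ≤ 1) {c : K} (hc : Valued.v c = WithZero.exp (-1 : ℤ))
    {x y : K} (hx : Valued.v (x - 1) ≤ WithZero.exp (-2 : ℤ)) (hy : Valued.v (y - 1) ≤ WithZero.exp (-2 : ℤ)) :
    Valued.v ((θ * x + (c - θ)) / ((c - σ θ) * x + σ θ) - (θ * y + (c - θ)) / ((c - σ θ) * y + σ θ)) = Valued.v (x - y) * WithZero.exp (1 : ℤ) := by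
  obtain ⟨-, hc1, -, -, -, -⟩ := shift_parameter_facts hc
  obtain ⟨hDx, -⟩ := valued_hermitianShift_scalar_denominators_of_deep σ hθ hθv hc hx
  obtain ⟨hDy, -⟩ := valued_hermitianShift_scalar_denominators_of_deep σ hθ hθv hc hy
  have hDx0 : (c - σ θ) * x + σ θ ≠ 0 := fun h => by rw [h, map_zero] at hDx; exact WithZero.zero_ne_coe hDx
  have hDy0 : (c - σ θ) * y + σ θ ≠ 0 := fun h => by rw [h, map_zero] at hDy; exact WithZero.zero_ne_coe hDy
  have h1c : Valued.v (1 - c) = 1 := Valuation.map_one_sub_of_lt _ hc1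
  have hΔ : Valued.v (θ * σ θ - (c - θ) * (c - σ θ)) = WithZero.exp (-1 : ℤ) := by
    rw [hermitianPair_key_scalar σ hθ c, map_mul, hc, h1c, mul_one]
  rw [genMoebius_scalar_sub_genMoebius_scalar _ _ _ _ _ _ hDx0 hDy0, map_div₀, map_mul, map_mul, hΔ, hDx, hDy, ← WithZero.exp_add,
    div_eq_iff (WithZero.exp_ne_zero), mul_comm (WithZero.exp (-1 : ℤ)) (Valued.v (x - y)), mul_assoc, ← WithZero.exp_add]
  norm_num

omit [Valued K ℤᵐ⁰] in
/-- **Roots shift with the matrix, four scalars**: if `χ_g(x) = 0` (`2 × 2`), `det(b′•g + a′•1) ≠ 0`, `b′x + a′ ≠ 0`, then `χ_{φ(g)}(φ(x)) = 0` (★ P2 `eval_charpoly_genMoebius_fin_two`).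
[cite: Kottwitz1986BaseChangeUnits, §2 pp. 244–247] [cite: Rogawski1990, §4.9 Prop. 4.9.1 (b) p. 55] -/
theorem isRoot_charpoly_genMoebius_of_isRoot (g : Matrix (Fin 2) (Fin 2) K) (a b a' b' x : K) (hD : (b' • g + a' • (1 : Matrix (Fin 2) (Fin 2) K)).det ≠ 0)
    (hx : b' * x + a' ≠ 0) (hr : g.charpoly.IsRoot x) :
    ((a • g + b • (1 : Matrix (Fin 2) (Fin 2) K)) * (b' • g + a' • (1 : Matrix (Fin 2) (Fin 2) K))⁻¹).charpoly.IsRoot ((a * x + b) / (b' * x + a')) := by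
  have key := eval_charpoly_genMoebius_fin_two g a b a' b' x hD hx
  rw [hr.eq_zero, mul_zero] at key
  rcases mul_eq_zero.1 key with h | h
  · rcases mul_eq_zero.1 h with h' | h'
    · exact h'
    · exact absurd ((pow_eq_zero_iff two_ne_zero).1 h') hx
  · exact absurd h hD

end Scalar

end Literature.NumberTheory.Automorphic.MoebiusShift

namespace Literature.NumberTheory.Rogawski1990

open Literature.NumberTheory.Automorphic Literature.NumberTheory.Automorphic.UnitaryGroup Literature.NumberTheory.Automorphic.MoebiusShift
open Literature.NumberTheory.GaloisRepresentations Literature.NumberTheory.NumberFields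

variable (L : Type) [Field L] [NumberField L] [IsCMField L] (v : HeightOneSpectrum (𝓞 ↥(maximalRealSubfield L)))
  (w : PlacesOver L v) (hw : IsCMField.complexConj L • w.1 = w.1)

/-! ## §2 Type-free: the hermitian Möbius denominators of a deep `γ_H` are units, under `|disc χ_{g_w}|_w < exp(−2)` -/

include hw in
/-- **THE HERMITIAN DENOMINATORS ARE UNITS — TYPE-FREE** (θ-twin of ★ `isUnit_shift_denominators_of_disc_lt`; twin of `isUnit_hermitianShift_denominators_of_typeTwo` with the
odd-valuation binder replaced by `|disc χ_{g_w}|_w < exp(−2)`, which is all its proof used): for a deep `γ_H = (g, u)` at a non-split `w` and `θ + σθ = 1`, `|θ_w| ≤ 1` (NO `|2|_w = 1`),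
`det((c−σθ)g + σθ)`, `det(θg + (c−θ))`, `(c−σθ)u + σθ`, `θu + (c−θ)` and `det((c−σθ)ι(γ_H) + σθ)` are units of `E_v`, with `w`-valuations `exp(−2), exp(−2), exp(−1), exp(−1)` for the
first four (★ P3 `valued_hermitianShift_denominators_of_unitary_of_exp`). [cite: Kottwitz1986BaseChangeUnits, §2 pp. 244–247] [cite: Rogawski1990, §4.9 Prop. 4.9.1 (b) p. 55] -/
theorem isUnit_hermitianShift_denominators_of_disc_lt
    (γH : (cmDatum L 2 (Matrix.of fun i j : Fin 2 => if i.val + j.val + 1 = 2 then (1 : L) else 0)).Local v ×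
      (cmDatum L 1 (Matrix.of fun i j : Fin 1 => if i.val + j.val + 1 = 1 then (1 : L) else 0)).Local v)
    {c : LocalRing L v} (hσc : conjLocal L (IsCMField.complexConj L) v c = c) (hc : Valued.v (c w) = WithZero.exp (-1 : ℤ))
    (θ : LocalRing L v) (hθ : θ + conjLocal L (IsCMField.complexConj L) v θ = 1) (hθv : Valued.v (θ w) ≤ 1)
    (hg1 : ∀ i j, Valued.v ((((γH.1.val : GL (Fin 2) (LocalRing L v)).val.map (Pi.evalRingHom (fun w' : PlacesOver L v => w'.1.adicCompletion L) w)) - 1) i j) ≤ Valued.v (c w))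
    (hu1 : Valued.v (finGammaTwo L v γH w - 1) ≤ Valued.v (c w))
    (hdisc : Valued.v (((γH.1.val : GL (Fin 2) (LocalRing L v)).val.map
        (Pi.evalRingHom (fun w' : PlacesOver L v => w'.1.adicCompletion L) w)).trace ^ 2 -
      4 * ((γH.1.val : GL (Fin 2) (LocalRing L v)).val.map
        (Pi.evalRingHom (fun w' : PlacesOver L v => w'.1.adicCompletion L) w)).det) < WithZero.exp (-2 : ℤ)) :
    Valued.v ((((c - conjLocal L (IsCMField.complexConj L) v θ) • ((γH.1.val : GL (Fin 2) (LocalRing L v)).val : Matrix (Fin 2) (Fin 2) (LocalRing L v)) +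
        conjLocal L (IsCMField.complexConj L) v θ • (1 : Matrix (Fin 2) (Fin 2) (LocalRing L v))).det) w) = WithZero.exp (-2 : ℤ) ∧
      Valued.v (((θ • ((γH.1.val : GL (Fin 2) (LocalRing L v)).val : Matrix (Fin 2) (Fin 2) (LocalRing L v)) + (c - θ) • (1 : Matrix (Fin 2) (Fin 2) (LocalRing L v))).det) w) =
        WithZero.exp (-2 : ℤ) ∧
      Valued.v (((c - conjLocal L (IsCMField.complexConj L) v θ) * finGammaTwo L v γH + conjLocal L (IsCMField.complexConj L) v θ) w) = WithZero.exp (-1 : ℤ) ∧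
      Valued.v ((θ * finGammaTwo L v γH + (c - θ)) w) = WithZero.exp (-1 : ℤ) ∧
      IsUnit ((((c - conjLocal L (IsCMField.complexConj L) v θ) • ((γH.1.val : GL (Fin 2) (LocalRing L v)).val : Matrix (Fin 2) (Fin 2) (LocalRing L v)) +
        conjLocal L (IsCMField.complexConj L) v θ • (1 : Matrix (Fin 2) (Fin 2) (LocalRing L v))).det)) ∧
      IsUnit (((θ • ((γH.1.val : GL (Fin 2) (LocalRing L v)).val : Matrix (Fin 2) (Fin 2) (LocalRing L v)) + (c - θ) • (1 : Matrix (Fin 2) (Fin 2) (LocalRing L v))).det)) ∧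
      IsUnit ((c - conjLocal L (IsCMField.complexConj L) v θ) * finGammaTwo L v γH + conjLocal L (IsCMField.complexConj L) v θ) ∧
      IsUnit (θ * finGammaTwo L v γH + (c - θ)) ∧
      IsUnit ((((c - conjLocal L (IsCMField.complexConj L) v θ) • ((γH.2.val : GL (Fin 1) (LocalRing L v)).val : Matrix (Fin 1) (Fin 1) (LocalRing L v)) +
        conjLocal L (IsCMField.complexConj L) v θ • (1 : Matrix (Fin 1) (Fin 1) (LocalRing L v))).det)) ∧
      IsUnit (((θ • ((γH.2.val : GL (Fin 1) (LocalRing L v)).val : Matrix (Fin 1) (Fin 1) (LocalRing L v)) + (c - θ) • (1 : Matrix (Fin 1) (Fin 1) (LocalRing L v))).det)) ∧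
      IsUnit (((c - conjLocal L (IsCMField.complexConj L) v θ) • (((endoEmbLocal L v γH).val : GL (Fin 3) (LocalRing L v)).val : Matrix (Fin 3) (Fin 3) (LocalRing L v)) +
        conjLocal L (IsCMField.complexConj L) v θ • (1 : Matrix (Fin 3) (Fin 3) (LocalRing L v))).det) := by
  have hv : Subsingleton (PlacesOver L v) := PlacesOver.subsingleton_of_smul_eq (IsCMField.complexConj L) (IsCMField.complexConj_ne_one L) w hw
  set evw : LocalRing L v →+* w.1.adicCompletion L := Pi.evalRingHom (fun w' : PlacesOver L v => w'.1.adicCompletion L) w with hevw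
  set σw := galAdicCompletionMap (L := L) (IsCMField.complexConj L) hw with hσw
  set gw : Matrix (Fin 2) (Fin 2) (w.1.adicCompletion L) := ((γH.1.val : GL (Fin 2) (LocalRing L v)).val.map evw) with hgw
  set uw : w.1.adicCompletion L := finGammaTwo L v γH w with huw
  set cw : w.1.adicCompletion L := c w with hcw
  obtain ⟨hc0, hc1, -, -, -, -⟩ := shift_parameter_facts hc
  have hσ : ∀ x, Valued.v (σw x) = Valued.v x := fun x => valued_galAdicCompletionMap (L := L) (IsCMField.complexConj L) hw x
  have hσcw : σw cw = cw := by
    have h := congrFun hσc w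
    rw [conjLocal_apply_eq_of_smul_eq (IsCMField.complexConj L) (IsCMField.complexConj_ne_one L) v w hw] at h
    exact h
  -- the hermitian parameter at `w`: `θ_w + σ_w θ_w = 1`
  have hSθ : (conjLocal L (IsCMField.complexConj L) v θ) w = σw (θ w) :=
    conjLocal_apply_eq_of_smul_eq (IsCMField.complexConj L) (IsCMField.complexConj_ne_one L) v w hw θ
  have hθw : θ w + σw (θ w) = 1 := by
    have h := congrFun hθ w
    rw [Pi.add_apply, hSθ, Pi.one_apply] at h
    exact h
  -- the `U(Φ₂)`-coordinate: `g_w = 1 + c_w X`, unitary for `J = antidiag(1, 1)`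
  set X : Matrix (Fin 2) (Fin 2) (w.1.adicCompletion L) := cw⁻¹ • (gw - 1) with hX
  have hgX : gw = 1 + cw • X := eq_one_add_smul_inv_smul_sub_one hc0 gw
  have hXi : ∀ i j, Valued.v (X i j) ≤ 1 := forall_valued_inv_smul_sub_one_le_one hc0 hg1
  have hunit : (((1 : Matrix (Fin 2) (Fin 2) (w.1.adicCompletion L)) + cw • X).map σw)ᵀ * !![(0 : w.1.adicCompletion L), 1; 1, 0] * ((1 : Matrix (Fin 2) (Fin 2) _) + cw • X) =
      !![(0 : w.1.adicCompletion L), 1; 1, 0] := by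
    have h := transpose_map_fst_evalRingHom_mul L v w hw γH
    rw [placeForm_antidiagTwo_eq] at h
    rw [← hgX]
    exact h
  have hJ : ∀ i j, Valued.v (!![(0 : w.1.adicCompletion L), 1; 1, 0] i j) ≤ 1 := by
    intro i j; fin_cases i <;> fin_cases j <;> simp
  have hJd : Valued.v (!![(0 : w.1.adicCompletion L), 1; 1, 0]).det = 1 := by
    rw [Matrix.det_fin_two_of, zero_mul, zero_sub, mul_one, Valuation.map_neg, map_one]
  have e2 : Valued.v cw ^ 2 = WithZero.exp (-2 : ℤ) := by rw [hc, ← WithZero.exp_nsmul]; norm_num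
  -- residual smallness of the discriminant of `X` from `hdisc` (★ `trace_sq_sub_four_det_one_add_smul`)
  have hdiscX : Valued.v (X.trace ^ 2 - 4 * X.det) < 1 := by
    have h := hdisc
    rw [hgX, trace_sq_sub_four_det_one_add_smul, map_mul, map_pow, e2] at h
    have h' : WithZero.exp (-2 : ℤ) * Valued.v (X.trace ^ 2 - 4 * X.det) < WithZero.exp (-2 : ℤ) * 1 := by rwa [mul_one]
    exact lt_of_mul_lt_mul_left' h'
  -- the `U(Φ₁)`-coordinate: `u_w = 1 + c_w y`, of norm one
  set y : w.1.adicCompletion L := cw⁻¹ * (uw - 1) with hy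
  have huy : uw = 1 + cw * y := by rw [hy, ← mul_assoc, mul_inv_cancel₀ hc0, one_mul, add_sub_cancel]
  have hyi : Valued.v y ≤ 1 := valued_inv_mul_sub_one_le_one hc0 hu1
  have hnorm : σw (1 + cw * y) * (1 + cw * y) = 1 := by rw [← huy]; exact map_finGammaTwo_mul_finGammaTwo L v w hw γH
  -- ★ P3: the four hermitian denominators at `w`
  obtain ⟨hDm, hDp, hum, hup⟩ := valued_hermitianShift_denominators_of_unitary_of_exp σw hσ hθv hθw hJ hJd hc hσcw hXi hdiscX hunit hyi hnorm
  rw [← hgX] at hDm hDp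
  rw [← huy] at hum hup
  -- reading the `E_v`-elements at `w`
  have hdet2 : ∀ a b : LocalRing L v, ((a • ((γH.1.val : GL (Fin 2) (LocalRing L v)).val : Matrix (Fin 2) (Fin 2) (LocalRing L v)) + b • (1 : Matrix (Fin 2) (Fin 2) (LocalRing L v))).det) w =
      (a w • gw + b w • (1 : Matrix (Fin 2) (Fin 2) (w.1.adicCompletion L))).det := fun a b => by
    have e1 : ((a • ((γH.1.val : GL (Fin 2) (LocalRing L v)).val : Matrix (Fin 2) (Fin 2) (LocalRing L v)) + b • (1 : Matrix (Fin 2) (Fin 2) (LocalRing L v))).det) w =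
        evw ((a • ((γH.1.val : GL (Fin 2) (LocalRing L v)).val : Matrix (Fin 2) (Fin 2) (LocalRing L v)) + b • (1 : Matrix (Fin 2) (Fin 2) (LocalRing L v))).det) := rfl
    rw [e1, RingHom.map_det, RingHom.mapMatrix_apply, map_smul_add_smul_one]
    rfl
  have hdet1 : ∀ a b : LocalRing L v, ((a • ((γH.2.val : GL (Fin 1) (LocalRing L v)).val : Matrix (Fin 1) (Fin 1) (LocalRing L v)) + b • (1 : Matrix (Fin 1) (Fin 1) (LocalRing L v))).det) w =
      a w * uw + b w := fun a b => by
    have e1 : ((a • ((γH.2.val : GL (Fin 1) (LocalRing L v)).val : Matrix (Fin 1) (Fin 1) (LocalRing L v)) + b • (1 : Matrix (Fin 1) (Fin 1) (LocalRing L v))).det) w =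
        evw ((a • ((γH.2.val : GL (Fin 1) (LocalRing L v)).val : Matrix (Fin 1) (Fin 1) (LocalRing L v)) + b • (1 : Matrix (Fin 1) (Fin 1) (LocalRing L v))).det) := rfl
    rw [e1, Matrix.det_fin_one]
    simp [evw, uw, finGammaTwo]
  have hsc : ∀ a b : LocalRing L v, ((a * finGammaTwo L v γH + b) w) = a w * uw + b w := fun a b => rfl
  have hSm : (c - conjLocal L (IsCMField.complexConj L) v θ) w = cw - σw (θ w) := by rw [Pi.sub_apply, hSθ]
  have hw2m : Valued.v ((((c - conjLocal L (IsCMField.complexConj L) v θ) • ((γH.1.val : GL (Fin 2) (LocalRing L v)).val : Matrix (Fin 2) (Fin 2) (LocalRing L v)) +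
      conjLocal L (IsCMField.complexConj L) v θ • (1 : Matrix (Fin 2) (Fin 2) (LocalRing L v))).det) w) = WithZero.exp (-2 : ℤ) := by
    rw [hdet2, hSm, hSθ]; exact hDm
  have hw2p : Valued.v (((θ • ((γH.1.val : GL (Fin 2) (LocalRing L v)).val : Matrix (Fin 2) (Fin 2) (LocalRing L v)) + (c - θ) • (1 : Matrix (Fin 2) (Fin 2) (LocalRing L v))).det) w) =
      WithZero.exp (-2 : ℤ) := by rw [hdet2]; exact hDp
  have hw1m : Valued.v (((c - conjLocal L (IsCMField.complexConj L) v θ) * finGammaTwo L v γH + conjLocal L (IsCMField.complexConj L) v θ) w) = WithZero.exp (-1 : ℤ) := by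
    rw [hsc, hSm, hSθ]; exact hum
  have hw1p : Valued.v ((θ * finGammaTwo L v γH + (c - θ)) w) = WithZero.exp (-1 : ℤ) := by rw [hsc]; exact hup
  have hne : ∀ {x : LocalRing L v} {z : ℤ}, Valued.v (x w) = WithZero.exp z → IsUnit x := fun {x z} hx =>
    isUnit_localRing_of_ne_zero_of_subsingleton L v hv fun h0 => by rw [h0, Pi.zero_apply, map_zero] at hx; exact WithZero.zero_ne_coe hx
  have hU2m := hne hw2m
  have hU2p := hne hw2p
  have hU1m := hne hw1m
  have hU1p := hne hw1p
  have hU1m' : IsUnit ((((c - conjLocal L (IsCMField.complexConj L) v θ) • ((γH.2.val : GL (Fin 1) (LocalRing L v)).val : Matrix (Fin 1) (Fin 1) (LocalRing L v)) +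
      conjLocal L (IsCMField.complexConj L) v θ • (1 : Matrix (Fin 1) (Fin 1) (LocalRing L v))).det)) :=
    hne (z := -1) (by rw [hdet1, hSm, hSθ]; exact hum)
  have hU1p' : IsUnit (((θ • ((γH.2.val : GL (Fin 1) (LocalRing L v)).val : Matrix (Fin 1) (Fin 1) (LocalRing L v)) + (c - θ) • (1 : Matrix (Fin 1) (Fin 1) (LocalRing L v))).det)) :=
    hne (z := -1) (by rw [hdet1]; exact hup)
  refine ⟨hw2m, hw2p, hw1m, hw1p, hU2m, hU2p, hU1m, hU1p, hU1m', hU1p', ?_⟩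
  -- the `3 × 3` denominator of `ι(γ_H)`: block diagonal
  have e3 : (c - conjLocal L (IsCMField.complexConj L) v θ) • (((endoEmbLocal L v γH).val : GL (Fin 3) (LocalRing L v)).val : Matrix (Fin 3) (Fin 3) (LocalRing L v)) +
        conjLocal L (IsCMField.complexConj L) v θ • (1 : Matrix (Fin 3) (Fin 3) (LocalRing L v)) =
      Matrix.reindex endoPerm endoPerm (Matrix.fromBlocks
        ((c - conjLocal L (IsCMField.complexConj L) v θ) • ((γH.1.val : GL (Fin 2) (LocalRing L v)).val : Matrix (Fin 2) (Fin 2) (LocalRing L v)) +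
          conjLocal L (IsCMField.complexConj L) v θ • (1 : Matrix (Fin 2) (Fin 2) (LocalRing L v))) 0 0
        ((c - conjLocal L (IsCMField.complexConj L) v θ) • ((γH.2.val : GL (Fin 1) (LocalRing L v)).val : Matrix (Fin 1) (Fin 1) (LocalRing L v)) +
          conjLocal L (IsCMField.complexConj L) v θ • (1 : Matrix (Fin 1) (Fin 1) (LocalRing L v)))) := by
    rw [coe_endoEmbLocal, coe_endoGL, smul_reindex_add_smul_one, smul_fromBlocks_add_smul_one]
  rw [e3, Matrix.det_reindex_self, Matrix.det_fromBlocks_zero₁₂]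
  exact hU2m.mul hU1m'

end Literature.NumberTheory.Rogawski1990

end
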